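import Mathlib
import Literature.Computability.AlgebraicComplexity.SecondFundamentalTheoremGL
import Summits.MatrixMultiplication.MatrixMultiplication.Theorems.LevelGradedCohnUmansLieRankDesignsStubFrameFnLevel

/-!
# Stub `stub_frameTomography` — line `ghost-calculus-chebotarev` of the crux
`SubgroupIdentityDesigns` (stmt-MatrixMultiplication-14079)

Crux
`Summit.MatrixMultiplication.MatrixMultiplication.Theses.LevelGradedCohnUmans.SubgroupIdentityDesigns`;
skeleton `Cruxes/SubgroupIdentityDesigns/Lines/ghost_calculus_chebotarev.lean` (registered stubs);
this file proves the registered stub `stub_frameTomography` verbatim (name + signature) and lands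
`--supports stmt-MatrixMultiplication-14079`.

Content (frame tomography).  `G = GL_m(𝔽_p)`, `ψ = ZMod.stdAddChar`.  For every `λ : G → ℂ` and
level `k`: all level-`k` Fourier sums vanish, `Σ_g λ(g) ψ(tr(M g)) = 0` for every `M ∈ M_m(𝔽_p)` of
rank `≤ k`, IFF all `k`-frame PLANE SUMS vanish, `Σ_{g : g U = C} λ(g) = 0` for all
`U, C ∈ M_{m×k}(𝔽_p)`.

* (→) `planeSum_eq_zero`: the plane indicator is a character sum,
  `[X = C] = p^{-mk} Σ_{V ∈ M_{k×m}} ψ(tr(V (X - C)))` (`indicator_eq_sum_psi`, from the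
  orthogonality relation `sum_psi_trace_mul` of the landed `StubFrameFnLevel` file), and
  `tr(V g U) = tr((U V) g)` (`trace_frame`) with `rk(U V) ≤ rk U ≤ k`, so each inner sum is a
  level-`k` Fourier sum.
* (←) `fourierSum_eq_zero`: a matrix of rank `≤ k` factors as `M = U W` through `𝔽_p^k`
  (`Literature.Computability.AlgebraicComplexity.exists_eq_mul_of_rank_le`, rank factorisation over
  a field), and then `ψ(tr(U W g)) = ψ(tr(W (g U))) = Σ_C [g U = C] ψ(tr(W C))`, so the Fourier sum
  is a combination of plane sums.
-/

set_option linter.dupNamespace false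

noncomputable section

open scoped BigOperators

namespace Summit.MatrixMultiplication.MatrixMultiplication.Theorems.GhostCalculusChebotarev

open Summit.MatrixMultiplication.MatrixMultiplication.Theorems.LieRankDesigns.Negative (GLm Mat)
open Summit.MatrixMultiplication.MatrixMultiplication.Theorems.LieRankDesigns.FrameFnLevel
  (trace_frame sum_psi_trace_mul)
open Literature.Computability.AlgebraicComplexity (exists_eq_mul_of_rank_le)

variable {p m : ℕ} [Fact p.Prime]

namespace FrameTomography

/-- **Plane indicator as a character sum**:
`[X = C] λ = λ p^{-mk} Σ_{V ∈ M_{k×m}(𝔽_p)} ψ(tr(V (X - C)))` (orthogonality of the trace pairing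
on `M_{m×k}(𝔽_p)`, `sum_psi_trace_mul`). [folklore] -/
theorem indicator_eq_sum_psi (k : ℕ) (lam : ℂ) (X C : Matrix (Fin m) (Fin k) (ZMod p)) :
    (if X = C then lam else 0) =
      lam * (((p : ℂ) ^ (m * k))⁻¹ * ∑ V : Matrix (Fin k) (Fin m) (ZMod p),
        ZMod.stdAddChar (Matrix.trace (V * (X - C)))) := by
  have hp0 : ((p : ℂ) ^ (m * k)) ≠ 0 := pow_ne_zero _ (Nat.cast_ne_zero.mpr (NeZero.ne p))
  rw [sum_psi_trace_mul]
  by_cases hXC : X = C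
  · rw [if_pos hXC, if_pos (sub_eq_zero.mpr hXC), inv_mul_cancel₀ hp0, mul_one]
  · rw [if_neg hXC, if_neg fun h0 => hXC (sub_eq_zero.mp h0), mul_zero, mul_zero]

/-- **(→) Fourier-orthogonality to the rank-`≤ k` modes kills every `k`-frame plane sum.**
`Σ_g [g U = C] λ(g) = p^{-mk} Σ_V ψ(-tr(V C)) Σ_g λ(g) ψ(tr((U V) g))`, and `rk(U V) ≤ k`.
[folklore] -/
theorem planeSum_eq_zero (k : ℕ) (lam : GLm p m → ℂ)
    (h : ∀ M : Mat p m, M.rank ≤ k →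
      ∑ g : GLm p m, lam g * ZMod.stdAddChar (Matrix.trace (M * (g : Mat p m))) = 0)
    (U C : Matrix (Fin m) (Fin k) (ZMod p)) :
    (∑ g : GLm p m, if (g : Mat p m) * U = C then lam g else 0) = 0 := by
  have hexp : ∀ g : GLm p m, (if (g : Mat p m) * U = C then lam g else 0) =
      ((p : ℂ) ^ (m * k))⁻¹ * ∑ V : Matrix (Fin k) (Fin m) (ZMod p),
        ZMod.stdAddChar (Matrix.trace (V * (-C))) *
          (lam g * ZMod.stdAddChar (Matrix.trace (U * V * (g : Mat p m)))) := by
    intro g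
    rw [indicator_eq_sum_psi, mul_left_comm, Finset.mul_sum]
    congr 1
    refine Finset.sum_congr rfl fun V _ => ?_
    rw [Matrix.mul_sub, Matrix.trace_sub, sub_eq_add_neg, AddChar.map_add_eq_mul, trace_frame,
      ← Matrix.trace_neg, ← Matrix.mul_neg]
    ring
  simp_rw [hexp]
  rw [← Finset.mul_sum, Finset.sum_comm, Finset.sum_eq_zero, mul_zero]
  intro V _
  rw [← Finset.mul_sum, h (U * V) ((Matrix.rank_mul_le_left U V).trans (Matrix.rank_le_width U)),
    mul_zero]

/-- **(←) Vanishing plane sums kill every rank-`≤ k` Fourier sum.**  Factor `M = U W` through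
`𝔽_p^k` (rank factorisation); then `λ(g) ψ(tr(U W g)) = Σ_C [g U = C] λ(g) ψ(tr(W C))`, and the
sum over `g` of each `C`-term is a plane sum. [folklore] -/
theorem fourierSum_eq_zero (k : ℕ) (lam : GLm p m → ℂ)
    (h : ∀ U C : Matrix (Fin m) (Fin k) (ZMod p),
      (∑ g : GLm p m, if (g : Mat p m) * U = C then lam g else 0) = 0)
    (M : Mat p m) (hM : M.rank ≤ k) :
    ∑ g : GLm p m, lam g * ZMod.stdAddChar (Matrix.trace (M * (g : Mat p m))) = 0 := by
  obtain ⟨U, W, rfl⟩ := exists_eq_mul_of_rank_le M hM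
  have hexp : ∀ g : GLm p m, lam g * ZMod.stdAddChar (Matrix.trace (U * W * (g : Mat p m))) =
      ∑ C : Matrix (Fin m) (Fin k) (ZMod p),
        (if (g : Mat p m) * U = C then lam g else 0) * ZMod.stdAddChar (Matrix.trace (W * C)) := by
    intro g
    simp_rw [ite_mul, zero_mul]
    rw [Finset.sum_ite_eq, if_pos (Finset.mem_univ _), trace_frame]
  simp_rw [hexp]
  rw [Finset.sum_comm]
  refine Finset.sum_eq_zero fun C _ => ?_
  rw [← Finset.sum_mul, h U C, zero_mul]

end FrameTomography

open FrameTomography in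
/-- **Stub `stub_frameTomography`** (registered signature; frame tomography).  For ANY
`λ : GL_m(𝔽_p) → ℂ` and level `k`: all level-`k` Fourier sums vanish
(`Σ_g λ(g) ψ(tr(M g)) = 0` for every `M ∈ M_m(𝔽_p)` of rank `≤ k`) IFF all `k`-frame PLANE SUMS
vanish (`Σ_{g : g U = C} λ(g) = 0` for all `U, C ∈ M_{m×k}(𝔽_p)`); equivalently
`F_k = span{1[g U = C]}` on `GL_m(𝔽_p)`.  (→) `1[g U = C] = p^{-mk} Σ_V ψ(tr(V (g U - C)))` with
`tr(V g U) = tr((U V) g)`, `rk(U V) ≤ k`; (←) rank factorisation `M = U W` and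
`ψ(tr(M g)) = Σ_C ψ(tr(W C)) 1[g U = C]`. -/
theorem stub_frameTomography (k : ℕ) (lam : Matrix.GeneralLinearGroup (Fin m) (ZMod p) → ℂ) :
    (∀ M : Matrix (Fin m) (Fin m) (ZMod p), M.rank ≤ k →
        ∑ g : Matrix.GeneralLinearGroup (Fin m) (ZMod p),
          lam g * ZMod.stdAddChar (Matrix.trace (M * (g : Matrix (Fin m) (Fin m) (ZMod p)))) = 0) ↔
      ∀ U C : Matrix (Fin m) (Fin k) (ZMod p),
        (∑ g : Matrix.GeneralLinearGroup (Fin m) (ZMod p),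
          if (g : Matrix (Fin m) (Fin m) (ZMod p)) * U = C then lam g else 0) = 0 := by
  exact ⟨fun h U C => planeSum_eq_zero k lam h U C, fun h M hM => fourierSum_eq_zero k lam h M hM⟩

end Summit.MatrixMultiplication.MatrixMultiplication.Theorems.GhostCalculusChebotarev

end
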